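import Summits.ResolutionOfSingularities.ResolutionOfSingularities.Theorems.PurelyInseparableDim4PointChain
import HarnessLib

/-!
# Purely inseparable four-folds: TERMINATION OF THE POINT-CENTRE WALK ⇒ ORDER REDUCTION in the single-point regime
# (brick TY-3j part 4c «ACC CHAIN», cell `res-dim4-pi`)

[OURS · counted 0] (D-0157 DOOR 2; the first kernel-checked instance of the frame `PIDim4.TerminationImpliesOrderReduction`
beyond bounded depth: arbitrary finite length, MODE 0 (point centres), SINGLE-POINT regime; host item
stmt-ResolutionOfSingularities-16155, helper). Resolution of singularities in dimension ≥ 4 / characteristic `p` is NOT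
proved here or anywhere in this programme.

Walk-side hypothesis, DEF-FREE: `Acc (fun s' s => PIDim4.Edge p univ s s') s₀` — the point-centre walk below the root
state `s₀ = (F, 0, ∅)` is well-founded, i.e. EVERY chain of edges out of `s₀` is finite (core `Acc`; this is what the
Target's termination predicates assert branch-wise). Geometric hypothesis («single-point regime»): along EVERY admissible
blow-up sequence of `M₀ = (𝔸⁵_K, (z^p + F)·𝒪, [], p)` the transformed marked ideal has AT MOST ONE closed point of order
`≥ p` (no branching; in particular the origin is the only order-`p` point of `z^p + F`).

* **`exists_isMarkedResolution_of_acc`** — the induction on `Acc`: for every admissible prefix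
  `IsMultipleBlowup M₀ σ M′` ending in INVARIANT(X′, M′, x′) with state `s`, `Acc _ s` ⇒ a marked resolution of `M₀`
  (blow up `x′`: empty support ⇒ done; else the unique survivor is over `x′`, `point_step_package` hands an EDGE
  `s → s₁` with a chart, and the induction hypothesis at `s₁` applies to the extended prefix);
* **`exists_isMarkedResolution_of_acc_root`** — the root case: `K = K̄`, `F ≠ 0` clean with `p ≤ ord₀ F`,
  `Acc (Edge p univ)ᵒᵖ (F, 0, ∅)` and the single-point regime ⇒
  `∃ X′ π M′, IsMarkedResolution ⟨hypSheaf p F, [], p⟩ π M′` — the conclusion of `PIDim4.OrderReduction p` for this `F`.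

AI-produced formalisation, weaker than expert review. bears_on: LADDER-RESOLUTION:D157-DOOR2 (res-dim4-pi · TY-3j).
-/

set_option linter.dupNamespace false -- D-0017: single-problem summit path `Summit.<S>.<S>.…` by design

noncomputable section

open MvPolynomial Finset CategoryTheory AlgebraicGeometry Opposite TopologicalSpace

namespace Summit.ResolutionOfSingularities.ResolutionOfSingularities.Theorems.PIDim4

open Literature.AlgebraicGeometry.Resolution
open Literature.AlgebraicGeometry.Resolution.Hauser2010
open Literature.AlgebraicGeometry.Resolution.AffinePointBlowup (P A γ coord Wtop ξ)

namespace Equimultiple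

section AccChain

variable {K : Type} [Field K] {p : ℕ} [hp : Fact p.Prime] [CharP K p]

/-- **INDUCTION ON THE WELL-FOUNDED WALK (single-point regime).** `M₀` a marked ideal on a locally Noetherian Jacobson
`X` with snc boundary and `mult M₀ = p`, such that along every admissible sequence `IsMultipleBlowup M₀ σ M′` the closed
points of order `≥ p` of `M′` number at most one. Then for every admissible prefix ending in INVARIANT(X′, M′, x′) with a
state `s` below which the point-centre walk is well-founded, `M₀` admits a marked resolution.
[cite: BierstoneGrigorievMilmanWlodarczyk2011, Def. 3.1.3] [cite: Hauser2010, §F] -/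
theorem exists_isMarkedResolution_of_acc {X : Scheme.{0}} [IsLocallyNoetherian X] [JacobsonSpace X] [IsAlgClosed K]
    [DecidableEq K] (M₀ : MarkedIdeal X) (hE : HasSNC M₀.boundary) (hmult : M₀.mult = p)
    (hone : ∀ (X' : Scheme.{0}) (σ : X' ⟶ X) (M' : MarkedIdeal X'), IsMultipleBlowup M₀ σ M' →
      ∀ w w' : X', IsClosed ({w} : Set X') → IsClosed ({w'} : Set X') →
        (p : ℕ∞) ≤ idealOrder M'.ideal w → (p : ℕ∞) ≤ idealOrder M'.ideal w' → w = w')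
    (s : State K) (hacc : Acc (fun s' s : State K => Edge p Finset.univ s s') s) :
    ∀ (X' : Scheme.{0}) (σ : X' ⟶ X) (M' : MarkedIdeal X') (_ : IsMultipleBlowup M₀ σ M') (x' : X')
      (hx' : IsClosed ({x'} : Set X')) (φ : P 4 K ⟶ X') (_ : IsOpenImmersion φ) (_ : φ (ξ 4 K) = x')
      (_ : M'.ideal.comap φ = hypSheaf p s.F) (_ : s.F ≠ 0)
      (_ : Literature.Barriers.ResolutionOfSingularities.HauserPerlega.IsClean p s.F)
      (_ : (p : ℕ∞) ≤ CentreBlowup.ordAlong (Finset.univ : Finset (Fin 4)) s.F),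
      ∃ (X'' : Scheme.{0}) (π : X'' ⟶ X) (M'' : MarkedIdeal X''), IsMarkedResolution M₀ π M'' := by
  induction hacc with
  | intro s _ ih =>
    intro X' σ M' h x' hx' φ _ hφ hM' hF hclean hperm
    haveI : IsLocallyNoetherian X' := h.isLocallyNoetherian
    haveI : JacobsonSpace X' := jacobsonSpace_of_isMultipleBlowup h
    -- blow up `x'`
    set C := Scheme.IdealSheafData.vanishingIdeal (⟨{x'}, hx'⟩ : Closeds X') with hC
    have hπ : IsBlowup (blowup.π C) C := blowup.isBlowup C
    have h₁ : IsMultipleBlowup M₀ (blowup.π C ≫ σ) (M'.transform (blowup.π C) C) :=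
      isMultipleBlowup_extend_point h hE hmult φ hx' hφ s hM' hperm hπ
    haveI : IsLocallyNoetherian (blowup C) := h₁.isLocallyNoetherian
    haveI : JacobsonSpace (blowup C) := jacobsonSpace_of_isMultipleBlowup h₁
    by_cases hempty : (M'.transform (blowup.π C) C).support = ∅
    · exact ⟨_, blowup.π C ≫ σ, _, h₁, hempty⟩
    · -- a surviving closed point of order `≥ p`; by the single-point regime at the PREVIOUS stage it lies over `x'`
      have hreg : Scheme.IsRegular (blowup C) := isRegular_of_isBlowup_point hx' (h.hasSNC_boundary hE) hπ
      obtain ⟨w, hw, hord⟩ : ∃ w : blowup C, IsClosed ({w} : Set (blowup C)) ∧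
          (p : ℕ∞) ≤ idealOrder (M'.transform (blowup.π C) C).ideal w := by
        by_contra hall
        push Not at hall
        refine hempty ((support_eq_empty_iff_forall_isClosed hreg _).mpr fun w hw => ?_)
        have hm : (M'.transform (blowup.π C) C).mult = p := h₁.mult_eq.trans hmult
        rw [hm]
        exact hall w hw
      have hwx : blowup.π C w = x' := by
        by_contra hne
        have hnot : blowup.π C w ∉ (C.support : Set X') :=
          fun hm => hne ((mem_support_vanishingIdeal_singleton_iff hx').mp hm)
        have h2 := hord
        rw [MarkedIdeal.transform_ideal, h.mult_eq.trans hmult,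
          hπ.idealOrder_controlledTransform_eq_of_not_mem _ hnot] at h2
        exact hne (hone X' σ M' h _ x' (isClosed_singleton_π' hπ hw) hx' h2
          (le_idealOrder_of_chart φ hφ M' s hM' hperm))
      -- the step package: an edge `s → s₁` and a chart at `w`; recurse
      obtain ⟨j, b, -, hedge, φ₁, _, hφ₁, hM₁⟩ :=
        point_step_package φ hx' hφ M' (h.mult_eq.trans hmult) s hM' hF hclean hperm hπ hw hwx hord
      obtain ⟨j'', b'', -, -, heq'', hF'', hs''⟩ := id hedge
      exact ih _ hedge _ (blowup.π C ≫ σ) _ h₁ w hw φ₁ inferInstance hφ₁ hM₁ (by rw [hs'']; exact hF'')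
        (isClean_step Finset.univ j b s)
        (by rw [hs'']; exact ordAlong_univ_step_of_isEquimultiplePoint j'' b'' s heq'')

/-- **TERMINATION ⇒ ORDER REDUCTION (MODE 0, single-point regime).** `K = K̄` of characteristic `p`, `F ≠ 0` clean with
`p ≤ ord₀ F`. If the point-centre walk below `(F, 0, ∅)` is well-founded (`Acc`: every chain of edges is finite) and
along every admissible blow-up sequence of `M₀ = (𝔸⁵_K, (z^p + F)·𝒪, [], p)` at most one closed point has order `≥ p`,
then `M₀` admits a marked resolution: the conclusion of `PIDim4.OrderReduction p` for this `F`. NOT `OrderReduction p`.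
[cite: BierstoneGrigorievMilmanWlodarczyk2011, Def. 3.1.3] [cite: Hironaka1964, Main Theorem I (the characteristic-zero
statement whose analogue is asked)] -/
theorem exists_isMarkedResolution_of_acc_root [IsAlgClosed K] [DecidableEq K] (F : MvPolynomial (Fin 4) K)
    (hF : F ≠ 0) (hclean : Literature.Barriers.ResolutionOfSingularities.HauserPerlega.IsClean p F)
    (hperm : (p : ℕ∞) ≤ CentreBlowup.ordAlong (Finset.univ : Finset (Fin 4)) F)
    (hacc : Acc (fun s' s : State K => Edge p Finset.univ s s') (⟨F, 0, ∅⟩ : State K))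
    (hone : ∀ (X' : Scheme.{0}) (σ : X' ⟶ P 4 K) (M' : MarkedIdeal X'),
      IsMultipleBlowup (⟨hypSheaf p F, [], p⟩ : MarkedIdeal (P 4 K)) σ M' →
      ∀ w w' : X', IsClosed ({w} : Set X') → IsClosed ({w'} : Set X') →
        (p : ℕ∞) ≤ idealOrder M'.ideal w → (p : ℕ∞) ≤ idealOrder M'.ideal w' → w = w') :
    ∃ (X' : Scheme.{0}) (π : X' ⟶ P 4 K) (M' : MarkedIdeal X'),
      IsMarkedResolution (⟨hypSheaf p F, [], p⟩ : MarkedIdeal (P 4 K)) π M' := by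
  have hE₀ : HasSNC ((⟨hypSheaf p F, [], p⟩ : MarkedIdeal (P 4 K))).boundary :=
    hasSNC_nil_of_isRegular (Literature.AlgebraicGeometry.Hironaka2017.Lib.AffinePointBlowupLSB.isRegular_Z 4 K)
  exact exists_isMarkedResolution_of_acc _ hE₀ rfl hone (⟨F, 0, ∅⟩ : State K) hacc (P 4 K) (𝟙 _) _
    (IsMultipleBlowup.refl _) (ξ 4 K) (AffinePointBlowup.isClosed_ξ 4 K) (𝟙 _) inferInstance rfl
    (Scheme.IdealSheafData.comap_id _) hF hclean hperm

end AccChain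

end Equimultiple

end Summit.ResolutionOfSingularities.ResolutionOfSingularities.Theorems.PIDim4

end
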